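import Literature.Probability.LatticeModels.RandomClusterFiniteVolumePressure
import Literature.Probability.LatticeModels.RandomClusterShiftedBoxes
import Literature.Probability.LatticeModels.FKIsingAnnulusCrossingProofs
import HarnessLib

/-!
# Equality of the wired and free edge densities of the random-cluster model on `ℤ^d` off a
# countable set of `p`, and its consequence for increasing box events

Topic `Literature/Probability/LatticeModels`. Grimmett 2006, Thm. (4.63) asserts, for `q ≥ 1` and
`p` outside a countable set `𝒟_q`, that the infinite-volume limits of the free and wired
random-cluster measures coincide; the proof there goes through the convexity of the pressure
(Thm. (4.58)). This file proves the consequence needed downstream — for a dense set of `p`, every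
increasing box event has wired limit probability at most its free limit probability — by the
finite-volume route of `RandomClusterFiniteVolumePressure.lean` (Jensen's tangent inequality for the
finite-volume pressure, the `(|∂Λ| - 1) log q` cost of the wired boundary condition, and Prop. (4.6)
in its coupling-free quantitative form), combined with the translation/symmetry invariance of the
limiting edge densities `h¹`, `h⁰` (`RandomClusterShiftedBoxes.lean`):

* `card_innerBoundary_box_le`, `card_box_pred_le_card_edgeFinset`, `tendsto_boundaryRatio` — the
  boundary of `Λ_N` is negligible against its edge set;
* `wiredEdgeDensity_le_freeEdgeDensity_of_lt` — **`h¹(p,q) ≤ h⁰(p',q)` for `0 < p < p' < 1`**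
  (Grimmett 2006, proof of Thm. (4.63), (4.73)–(4.76), here without the pressure);
* `freeEdgeDensity_le_wiredEdgeDensity` — `h⁰ ≤ h¹`;
* `countable_setOf_freeEdgeDensity_lt`, `exists_mem_Ioo_freeEdgeDensity_eq` — the set of `p` with
  `h⁰(p,q) < h¹(p,q)` is countable (the intervals `(h⁰(p), h¹(p))` are pairwise disjoint), so every
  non-trivial interval of `p` contains a point where `h⁰ = h¹` (Grimmett 2006, Thm. (4.63) (a)⇔(c)
  and Thm. (4.60): `𝒟_q` is countable);
* `iInf_wired_le_iSup_free_of_densities_eq` — at such `p`, for every `m` and every increasing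
  event `A` of the configurations of `Λ_m`,
  `inf_N φ¹_{Λ_N,p,q}(A) ≤ sup_N φ⁰_{Λ_N,p,q}(A)` (Grimmett 2006, Thm. (4.63) (c)⇒(d) via
  Prop. (4.6)).

Everything is proved; no named facts.

## References

* G. Grimmett, *The Random-Cluster Model*, Springer 2006: Prop. (4.6), Thm. (4.19), (4.61),
  Thm. (4.60), Thm. (4.63) and its proof (4.73)–(4.76). [Grimmett2006]
-/

noncomputable section

open MeasureTheory Finset SimpleGraph Filter Topology
open Literature.Probability.Percolation

namespace Literature.Probability.LatticeModels

variable {d : ℕ}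

/-! ### Edges of the box graph as edges of `ℤ^d` -/

section BoxEdges

/-- An edge of the box graph is an edge of `ℤ^d`. [cite: Grimmett2006, §4.2 (E_Λ)] -/
theorem map_val_mem_edgeSet_of_mem_edgeFinset {N : ℕ} {e' : Sym2 ↥(box d N)}
    (he' : e' ∈ (finsetGraph (zdGraph d) (box d N)).edgeFinset) :
    e'.map Subtype.val ∈ (zdGraph d).edgeSet := by
  induction e' using Sym2.ind with
  | h u v =>
    rw [mem_edgeFinset, mem_edgeSet] at he'
    rw [Sym2.map_mk, mem_edgeSet]
    exact he'

/-- Both endpoints of an edge of `Λ_N` lie in `Λ_N`: its radius is at most `N`. [cite: Grimmett2006, §4.2 (E_Λ)] -/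
theorem pairRad_map_val_le {N : ℕ} (e' : Sym2 ↥(box d N)) : pairRad (e'.map Subtype.val) ≤ N := by
  induction e' using Sym2.ind with
  | h u v =>
    rw [Sym2.map_mk, pairRad_mk, max_le_iff]
    exact ⟨mem_box_iff_siteRad_le.1 u.2, mem_box_iff_siteRad_le.1 v.2⟩

/-- The event `J_{e'}` of a pair of box vertices is the event `eOpen Λ_N e` of the underlying pair of
lattice points. [cite: Grimmett2006, (4.61) (J_e)] -/
theorem edgeOpen_eq_eOpen_map_val {N : ℕ} (e' : Sym2 ↥(box d N)) :
    edgeOpen e' = eOpen (box d N) (e'.map Subtype.val) := by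
  ext ω
  rw [mem_edgeOpen_iff, mem_eOpen_iff]
  constructor
  · intro h; exact ⟨e', h, rfl⟩
  · rintro ⟨e'', he'', heq⟩
    rwa [← Sym2.map.injective Subtype.val_injective heq]

/-- Lifting a pair along an inclusion of boxes does not change the underlying pair of lattice
points. [folklore] -/
theorem map_val_edgeLift {Λ Δ : Finset (Site d)} (h : Λ ⊆ Δ) (e : Sym2 ↥Λ) :
    (edgeLift h e).map Subtype.val = e.map Subtype.val := by
  induction e using Sym2.ind with
  | h u v => rw [edgeLift_mk, Sym2.map_mk, Sym2.map_mk]; rfl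

/-- A pair that is not an edge of the graph is open with probability zero (the measure lives on edge
sets). [cite: Grimmett2006, §1.2, eq. (1.2)] -/
theorem rcMeasure_real_edgeOpen_eq_zero_of_notMem {V : Type*} [Fintype V] [DecidableEq V]
    (G : SimpleGraph V) [DecidableRel G.Adj] {p q : ℝ} (hp : p ∈ Set.Icc (0 : ℝ) 1) (hq : 0 < q)
    (B : Set V) {e : Sym2 V} (he : e ∉ G.edgeSet) : (rcMeasure G p q B).real (edgeOpen e) = 0 := by
  refine le_antisymm ?_ measureReal_nonneg
  have h := rcMeasure_real_mono_on_edgeSets G hp hq B (A := edgeOpen e) (A' := ∅)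
    (fun ω hω hmem => he (hω hmem))
  rwa [measureReal_empty] at h

/-- **Wired box probabilities of single edges dominate `h¹`**: for an edge `e'` of `Λ_N`,
`h¹(p,q) ≤ φ¹_{Λ_N,p,q}(J_{e'})`, with `h¹` evaluated at any edge `e` of `ℤ^d`.
[cite: Grimmett2006, proof of Thm. (4.63), eq. (4.75)] -/
theorem wiredEdgeDensity_le_real_edgeOpen (hd : 0 < d) {p q : ℝ} (hp : p ∈ Set.Icc (0 : ℝ) 1)
    (hq : 1 ≤ q) {e : Sym2 (Site d)} (he : e ∈ (zdGraph d).edgeSet) {N : ℕ} {e' : Sym2 ↥(box d N)}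
    (he' : e' ∈ (finsetGraph (zdGraph d) (box d N)).edgeFinset) :
    wiredEdgeDensity d p q e ≤
      (rcMeasure (finsetGraph (zdGraph d) (box d N)) p q (wiredBoundary (zdGraph d) (box d N))).real
        (edgeOpen e') := by
  rw [wiredEdgeDensity_eq_of_mem_edgeSet hd hp hq he (map_val_mem_edgeSet_of_mem_edgeFinset he'),
    edgeOpen_eq_eOpen_map_val]
  exact wiredEdgeDensity_le_boxWiredEdgeProb (pairRad_map_val_le e')

/-- **Free box probabilities of single edges are dominated by `h⁰`**: for an edge `e'` of `Λ_N`,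
`φ⁰_{Λ_N,p,q}(J_{e'}) ≤ h⁰(p,q)`. [cite: Grimmett2006, proof of Thm. (4.63), eq. (4.75)] -/
theorem real_edgeOpen_le_freeEdgeDensity {p q : ℝ} (hp : p ∈ Set.Icc (0 : ℝ) 1)
    (hq : 1 ≤ q) {e : Sym2 (Site d)} (he : e ∈ (zdGraph d).edgeSet) {N : ℕ} {e' : Sym2 ↥(box d N)}
    (he' : e' ∈ (finsetGraph (zdGraph d) (box d N)).edgeFinset) :
    (rcMeasure (finsetGraph (zdGraph d) (box d N)) p q ∅).real (edgeOpen e') ≤ freeEdgeDensity d p q e := by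
  rw [freeEdgeDensity_eq_of_mem_edgeSet hp hq he (map_val_mem_edgeSet_of_mem_edgeFinset he'),
    edgeOpen_eq_eOpen_map_val]
  exact boxFreeEdgeProb_le_freeEdgeDensity hp (one_pos.trans_le hq) (pairRad_map_val_le e')

end BoxEdges

/-! ### Counting: the boundary of `Λ_N` is negligible against its edge set -/

section Counting

/-- The wired boundary of `Λ_N` as a finite set of box vertices. [cite: Grimmett2006, §4.2 (∂Λ)] -/
def boxBoundaryFinset (d N : ℕ) : Finset ↥(box d N) :=
  Finset.univ.filter fun x => x.1 ∈ innerBoundary (zdGraph d) (box d N)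

/-- Its coercion is the wired boundary set. [cite: Grimmett2006, §4.2 (∂Λ)] -/
theorem coe_boxBoundaryFinset (d N : ℕ) :
    (↑(boxBoundaryFinset d N) : Set ↥(box d N)) = wiredBoundary (zdGraph d) (box d N) := by
  ext x
  simp [boxBoundaryFinset, mem_wiredBoundary_iff]

/-- A boundary vertex of `Λ_N` (`N ≥ 1`) is not in `Λ_{N-1}`. [cite: Grimmett2006, §4.2 (∂Λ)] -/
theorem notMem_box_pred_of_mem_innerBoundary {N : ℕ} (hN : 1 ≤ N) {x : Site d}
    (hx : x ∈ innerBoundary (zdGraph d) (box d N)) : x ∉ box d (N - 1) := by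
  obtain ⟨hxN, y, hy, hxy⟩ := mem_innerBoundary_iff.1 hx
  intro hx'
  rw [mem_box] at hxN hx'
  rw [mem_box, not_forall] at hy
  obtain ⟨j, hj⟩ := hy
  obtain ⟨i, h | h⟩ := (zdGraph_adj_iff _ _).1 hxy
  · have h1 := hx' j
    have h2 := hxN j
    rw [h] at hj
    by_cases hji : j = i
    · subst hji
      rw [Pi.add_apply, Pi.single_eq_same] at hj
      omega
    · rw [Pi.add_apply, Pi.single_eq_of_ne hji, add_zero] at hj
      omega
  · have h1 := hx' j
    have hxj : x j = y j + (Pi.single i (1 : ℤ) : Site d) j := by rw [h]; rfl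
    by_cases hji : j = i
    · subst hji
      rw [Pi.single_eq_same] at hxj
      omega
    · rw [Pi.single_eq_of_ne hji, add_zero] at hxj
      omega

/-- **`|∂Λ_N| ≤ (2N+1)^d - (2N-1)^d`** for `N ≥ 1`. [cite: Grimmett2006, proof of Thm. (4.58) (|∂Λ|/|E_Λ| → 0)] -/
theorem card_innerBoundary_box_le {N : ℕ} (hN : 1 ≤ N) :
    (#(innerBoundary (zdGraph d) (box d N)) : ℝ) ≤ (2 * N + 1 : ℝ) ^ d - (2 * N - 1 : ℝ) ^ d := by
  have hsub : innerBoundary (zdGraph d) (box d N) ⊆ box d N \ box d (N - 1) := by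
    intro x hx
    rw [Finset.mem_sdiff]
    exact ⟨(mem_innerBoundary_iff.1 hx).1, notMem_box_pred_of_mem_innerBoundary hN hx⟩
  have h := Finset.card_le_card hsub
  rw [Finset.card_sdiff_of_subset (box_mono d (Nat.sub_le N 1)), card_box, card_box] at h
  have hle : (2 * (N - 1) + 1) ^ d ≤ (2 * N + 1) ^ d :=
    Nat.pow_le_pow_left (by omega) d
  have hcast : ((2 * (N - 1) + 1 : ℕ) : ℝ) = 2 * N - 1 := by
    rw [Nat.cast_add, Nat.cast_mul, Nat.cast_sub hN]; push_cast; ring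
  have h' : (#(innerBoundary (zdGraph d) (box d N)) : ℝ) ≤ ((2 * N + 1) ^ d - (2 * (N - 1) + 1) ^ d : ℕ) := by
    exact_mod_cast h
  rw [Nat.cast_sub hle, Nat.cast_pow, Nat.cast_pow, hcast] at h'
  push_cast at h'
  exact h'

/-- The boundary finite set has the cardinality of `∂Λ_N`. [cite: Grimmett2006, §4.2 (∂Λ)] -/
theorem card_boxBoundaryFinset_le (d N : ℕ) :
    #(boxBoundaryFinset d N) ≤ #(innerBoundary (zdGraph d) (box d N)) := by
  refine Finset.card_le_card_of_injOn (fun x => x.1) (fun x hx => ?_) ?_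
  · exact (Finset.mem_filter.1 hx).2
  · intro x _ y _ hxy
    exact Subtype.ext hxy

/-- **`|E_{Λ_N}| ≥ (2N-1)^d`** for `N ≥ 1` (the edges `⟨x, x + e₀⟩`, `x ∈ Λ_{N-1}`, are distinct).
[cite: Grimmett2006, proof of Thm. (4.58) (|∂Λ|/|E_Λ| → 0)] -/
theorem card_box_pred_le_card_edgeFinset (hd : 0 < d) {N : ℕ} (hN : 1 ≤ N) :
    #(box d (N - 1)) ≤ #(finsetGraph (zdGraph d) (box d N)).edgeFinset := by
  classical
  set i₀ : Fin d := ⟨0, hd⟩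
  have h0 : (0 : Site d) ∈ box d N := zero_mem_box d N
  -- the edge `⟨x, x + e₀⟩` for `x ∈ Λ_{N-1}`, junk elsewhere
  set f : Site d → Sym2 ↥(box d N) := fun x =>
    if hx : x ∈ box d N ∧ x + Pi.single i₀ 1 ∈ box d N then s(⟨x, hx.1⟩, ⟨x + Pi.single i₀ 1, hx.2⟩)
    else s(⟨0, h0⟩, ⟨0, h0⟩) with hf
  have hmem : ∀ x ∈ box d (N - 1), x ∈ box d N ∧ x + Pi.single i₀ 1 ∈ box d N := by
    intro x hx
    refine ⟨box_mono d (Nat.sub_le N 1) hx, ?_⟩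
    rw [mem_box] at hx ⊢
    intro j
    have := hx j
    by_cases hji : j = i₀
    · subst hji; rw [Pi.add_apply, Pi.single_eq_same]; omega
    · rw [Pi.add_apply, Pi.single_eq_of_ne hji, add_zero]; omega
  refine Finset.card_le_card_of_injOn f (fun x hx => ?_) ?_
  · rw [Finset.mem_coe, mem_edgeFinset, hf]
    dsimp only
    rw [dif_pos (hmem x hx), mem_edgeSet]
    exact (zdGraph_adj_iff _ _).2 ⟨i₀, Or.inl rfl⟩
  · intro x hx y hy hxy
    rw [Finset.mem_coe] at hx hy
    rw [hf] at hxy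
    dsimp only at hxy
    rw [dif_pos (hmem x hx), dif_pos (hmem y hy), Sym2.eq_iff] at hxy
    rcases hxy with ⟨h1, -⟩ | ⟨h1, h2⟩
    · exact congrArg Subtype.val h1
    · have h1' := congrArg Subtype.val h1
      have h2' := congrArg Subtype.val h2
      simp only at h1' h2'
      have : (x + Pi.single i₀ 1 + Pi.single i₀ 1 : Site d) i₀ = x i₀ := by rw [h2', ← h1']
      rw [Pi.add_apply, Pi.add_apply, Pi.single_eq_same] at this
      omega

/-- The ratio `((2N+1)^d - (2N-1)^d)/(2N-1)^d → 0`. [folklore] -/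
theorem tendsto_boundaryRatio (d : ℕ) :
    Tendsto (fun N : ℕ => ((2 * N + 1 : ℝ) ^ d - (2 * N - 1 : ℝ) ^ d) / (2 * N - 1 : ℝ) ^ d)
      atTop (𝓝 0) := by
  -- `(2N+1)/(2N-1) = 1 + 2/(2N-1) → 1`
  have h1 : Tendsto (fun N : ℕ => (2 * (N : ℝ) - 1)) atTop atTop := by
    refine tendsto_atTop_add_const_right _ (-1) ?_
    exact Tendsto.const_mul_atTop two_pos tendsto_natCast_atTop_atTop
  have h2 : Tendsto (fun N : ℕ => 1 + 2 / (2 * (N : ℝ) - 1)) atTop (𝓝 1) := by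
    have := (tendsto_const_nhds (x := (2 : ℝ))).div_atTop h1
    simpa using tendsto_const_nhds.add this
  have h3 : Tendsto (fun N : ℕ => (1 + 2 / (2 * (N : ℝ) - 1)) ^ d - 1) atTop (𝓝 0) := by
    simpa using (h2.pow d).sub_const 1
  refine h3.congr' ?_
  filter_upwards [eventually_ge_atTop 1] with N hN
  have hpos : (0 : ℝ) < 2 * N - 1 := by
    have : (1 : ℝ) ≤ N := by exact_mod_cast hN
    linarith
  rw [sub_div, div_self (pow_pos hpos d).ne', ← div_pow]
  congr 2
  field_simp
  ring

end Counting

/-! ### `h¹(p) ≤ h⁰(p')` for `p < p'`, and `h⁰ ≤ h¹` -/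

section MainInequality

/-- `h⁰(p,q) ≤ h¹(p,q)`: the free measure is dominated by the wired one in every box.
[cite: Grimmett2006, proof of Thm. (4.63), eq. (4.75)] -/
theorem freeEdgeDensity_le_wiredEdgeDensity (hd : 0 < d) {p q : ℝ} (hp : p ∈ Set.Icc (0 : ℝ) 1)
    (hq : 1 ≤ q) (e : Sym2 (Site d)) : freeEdgeDensity d p q e ≤ wiredEdgeDensity d p q e := by
  refine le_of_tendsto_of_tendsto' (tendsto_boxFreeEdgeProb hp hq e) (tendsto_boxWiredEdgeProb hd hp hq e)
    fun N => ?_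
  exact rcMeasure_real_mono_wired_of_isUpperSet _ hp hq (Set.empty_subset _) (isUpperSet_eOpen _ e)

/-- **`h¹(p,q) ≤ h⁰(p',q)` whenever `0 < p < p' < 1`** (`q ≥ 1`, `d ≥ 1`): the wired edge density at
the smaller parameter does not exceed the free edge density at the larger one. This is the content
of Grimmett 2006, proof of Thm. (4.63), (4.73)–(4.76), obtained here in finite volume: in `Λ_N`,
`[log(p'/p) + log((1-p)/(1-p'))] (|E_{Λ_N}| h¹(p) - |E_{Λ_N}| h⁰(p')) ≤ |∂Λ_N| log q`
(`mul_sub_sum_edgeOpen_le` with (4.75)), and `|∂Λ_N|/|E_{Λ_N}| → 0`.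
[cite: Grimmett2006, proof of Thm. (4.63), (4.73)–(4.76)] -/
theorem wiredEdgeDensity_le_freeEdgeDensity_of_lt (hd : 0 < d) {p p' q : ℝ} (hp : 0 < p)
    (hpp' : p < p') (hp' : p' < 1) (hq : 1 ≤ q) {e : Sym2 (Site d)} (he : e ∈ (zdGraph d).edgeSet) :
    wiredEdgeDensity d p q e ≤ freeEdgeDensity d p' q e := by
  have hpc : p ∈ Set.Icc (0 : ℝ) 1 := ⟨hp.le, (hpp'.trans hp').le⟩
  have hp'c : p' ∈ Set.Icc (0 : ℝ) 1 := ⟨(hp.trans hpp').le, hp'.le⟩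
  set κ := Real.log (p' / p) + Real.log ((1 - p) / (1 - p')) with hκ
  have hκpos : 0 < κ := by
    have h1 : 0 < Real.log (p' / p) := Real.log_pos ((one_lt_div hp).2 hpp')
    have h2 : 0 < Real.log ((1 - p) / (1 - p')) :=
      Real.log_pos ((one_lt_div (sub_pos.2 hp')).2 (by linarith))
    linarith
  have hlogq : 0 ≤ Real.log q := Real.log_nonneg hq
  set δ := wiredEdgeDensity d p q e - freeEdgeDensity d p' q e with hδ
  -- the finite-volume inequality in `Λ_N`, `N ≥ 1`
  have key : ∀ N : ℕ, 1 ≤ N →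
      δ ≤ Real.log q / κ * (((2 * N + 1 : ℝ) ^ d - (2 * N - 1 : ℝ) ^ d) / (2 * N - 1 : ℝ) ^ d) := by
    intro N hN
    set G := finsetGraph (zdGraph d) (box d N)
    have hA := mul_sub_sum_edgeOpen_le G hp hpp' hp' hq (boxBoundaryFinset d N)
    rw [coe_boxBoundaryFinset] at hA
    -- compare the sums with `|E| h¹(p)` and `|E| h⁰(p')`
    have hW : (#G.edgeFinset : ℝ) * wiredEdgeDensity d p q e ≤
        ∑ e' ∈ G.edgeFinset, (rcMeasure G p q (wiredBoundary (zdGraph d) (box d N))).real (edgeOpen e') := by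
      rw [← nsmul_eq_mul, ← Finset.sum_const]
      exact Finset.sum_le_sum fun e' he' => wiredEdgeDensity_le_real_edgeOpen hd hpc hq he he'
    have hF : ∑ e' ∈ G.edgeFinset, (rcMeasure G p' q ∅).real (edgeOpen e') ≤
        (#G.edgeFinset : ℝ) * freeEdgeDensity d p' q e := by
      rw [← nsmul_eq_mul, ← Finset.sum_const]
      exact Finset.sum_le_sum fun e' he' => real_edgeOpen_le_freeEdgeDensity hp'c hq he he'
    -- boundary and edge counts
    have hB : (max ((#(boxBoundaryFinset d N) : ℝ) - 1) 0) * Real.log q ≤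
        ((2 * N + 1 : ℝ) ^ d - (2 * N - 1 : ℝ) ^ d) * Real.log q := by
      refine mul_le_mul_of_nonneg_right ?_ hlogq
      refine max_le ?_ ?_
      · have h1 : (#(boxBoundaryFinset d N) : ℝ) ≤ #(innerBoundary (zdGraph d) (box d N)) := by
          exact_mod_cast card_boxBoundaryFinset_le d N
        linarith [card_innerBoundary_box_le (d := d) hN]
      · have h1 : (2 * N - 1 : ℝ) ^ d ≤ (2 * N + 1 : ℝ) ^ d := by
          have : (1 : ℝ) ≤ N := by exact_mod_cast hN
          exact pow_le_pow_left₀ (by linarith) (by linarith) d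
        linarith
    have hE : (2 * N - 1 : ℝ) ^ d ≤ #G.edgeFinset := by
      have h1 := card_box_pred_le_card_edgeFinset hd hN
      rw [card_box] at h1
      have h2 : ((2 * (N - 1) + 1 : ℕ) : ℝ) = 2 * N - 1 := by
        rw [Nat.cast_add, Nat.cast_mul, Nat.cast_sub hN]; push_cast; ring
      have h3 : (((2 * (N - 1) + 1) ^ d : ℕ) : ℝ) ≤ #G.edgeFinset := by exact_mod_cast h1
      rwa [Nat.cast_pow, h2] at h3
    have hpos : (0 : ℝ) < (2 * N - 1) ^ d := by
      have : (1 : ℝ) ≤ N := by exact_mod_cast hN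
      exact pow_pos (by linarith) d
    -- combine: `κ |E| δ ≤ ((2N+1)^d - (2N-1)^d) log q`
    have hcomb : κ * ((#G.edgeFinset : ℝ) * δ) ≤ ((2 * N + 1 : ℝ) ^ d - (2 * N - 1 : ℝ) ^ d) * Real.log q := by
      have : (#G.edgeFinset : ℝ) * δ ≤
          ∑ e' ∈ G.edgeFinset, (rcMeasure G p q (wiredBoundary (zdGraph d) (box d N))).real (edgeOpen e') -
            ∑ e' ∈ G.edgeFinset, (rcMeasure G p' q ∅).real (edgeOpen e') := by
        rw [hδ, mul_sub]; linarith
      calc κ * ((#G.edgeFinset : ℝ) * δ)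
          ≤ κ * (∑ e' ∈ G.edgeFinset, (rcMeasure G p q (wiredBoundary (zdGraph d) (box d N))).real (edgeOpen e') -
              ∑ e' ∈ G.edgeFinset, (rcMeasure G p' q ∅).real (edgeOpen e')) :=
            mul_le_mul_of_nonneg_left this hκpos.le
        _ ≤ _ := hA.trans hB
    -- divide
    by_cases hδ0 : δ ≤ 0
    · refine hδ0.trans (mul_nonneg (div_nonneg hlogq hκpos.le) (div_nonneg ?_ hpos.le))
      have : (1 : ℝ) ≤ N := by exact_mod_cast hN
      linarith [pow_le_pow_left₀ (show (0:ℝ) ≤ 2 * N - 1 by linarith) (show (2 * N - 1 : ℝ) ≤ 2 * N + 1 by linarith) d]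
    · push Not at hδ0
      have h1 : κ * ((2 * N - 1 : ℝ) ^ d * δ) ≤ ((2 * N + 1 : ℝ) ^ d - (2 * N - 1 : ℝ) ^ d) * Real.log q :=
        le_trans (mul_le_mul_of_nonneg_left (mul_le_mul_of_nonneg_right hE hδ0.le) hκpos.le) hcomb
      rw [div_mul_div_comm, le_div_iff₀ (mul_pos hκpos hpos)]
      linarith
  -- let `N → ∞`
  have hlim : Tendsto (fun N : ℕ => Real.log q / κ *
      (((2 * N + 1 : ℝ) ^ d - (2 * N - 1 : ℝ) ^ d) / (2 * N - 1 : ℝ) ^ d)) atTop (𝓝 0) := by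
    simpa using (tendsto_boundaryRatio d).const_mul (Real.log q / κ)
  have : δ ≤ 0 := ge_of_tendsto hlim (by
    filter_upwards [eventually_ge_atTop 1] with N hN
    exact key N hN)
  linarith

/-- **The set of `p ∈ (0,1)` with `h⁰(p,q) < h¹(p,q)` is countable** (`q ≥ 1`, `d ≥ 1`): the open
intervals `(h⁰(p), h¹(p))` attached to its points are non-empty and pairwise disjoint (by
`wiredEdgeDensity_le_freeEdgeDensity_of_lt`). This is Grimmett 2006, Thm. (4.63) (a)⇔(c) with the
countability of `𝒟_q` (Thm. (4.60)), obtained without the pressure.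
[cite: Grimmett2006, Thm. (4.63) and Thm. (4.60)] -/
theorem countable_setOf_freeEdgeDensity_lt (hd : 0 < d) {q : ℝ} (hq : 1 ≤ q) {e : Sym2 (Site d)}
    (he : e ∈ (zdGraph d).edgeSet) :
    {p : ℝ | p ∈ Set.Ioo (0 : ℝ) 1 ∧ freeEdgeDensity d p q e < wiredEdgeDensity d p q e}.Countable := by
  refine Set.PairwiseDisjoint.countable_of_isOpen
    (s := fun p => Set.Ioo (freeEdgeDensity d p q e) (wiredEdgeDensity d p q e)) ?_
    (fun p _ => isOpen_Ioo) (fun p hp => Set.nonempty_Ioo.2 hp.2)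
  intro p hp p' hp' hne
  rw [Function.onFun, Set.disjoint_iff]
  rintro x ⟨hx, hx'⟩
  rcases lt_or_gt_of_ne hne with hlt | hlt
  · have := wiredEdgeDensity_le_freeEdgeDensity_of_lt hd hp.1.1 hlt hp'.1.2 hq he
    exact absurd (hx.2.trans_le (this.trans hx'.1.le)) (lt_irrefl x)
  · have := wiredEdgeDensity_le_freeEdgeDensity_of_lt hd hp'.1.1 hlt hp.1.2 hq he
    exact absurd (hx'.2.trans_le (this.trans hx.1.le)) (lt_irrefl x)

/-- **Every non-trivial interval of parameters contains a point where `h⁰ = h¹` for all edges**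
(`q ≥ 1`, `d ≥ 1`): a countable set does not exhaust an interval.
[cite: Grimmett2006, Thm. (4.63) and Thm. (4.60)] -/
theorem exists_mem_Ioo_freeEdgeDensity_eq (hd : 0 < d) {q : ℝ} (hq : 1 ≤ q) {u v : ℝ} (hu : 0 ≤ u)
    (huv : u < v) (hv : v ≤ 1) :
    ∃ p ∈ Set.Ioo u v, ∀ e ∈ (zdGraph d).edgeSet, freeEdgeDensity d p q e = wiredEdgeDensity d p q e := by
  -- a reference edge
  set e₀ : Sym2 (Site d) := s(0, Pi.single ⟨0, hd⟩ 1) with he₀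
  have he₀E : e₀ ∈ (zdGraph d).edgeSet := by
    rw [mem_edgeSet]; exact (zdGraph_adj_iff _ _).2 ⟨⟨0, hd⟩, Or.inl (by rw [zero_add])⟩
  set bad := {p : ℝ | p ∈ Set.Ioo (0 : ℝ) 1 ∧ freeEdgeDensity d p q e₀ < wiredEdgeDensity d p q e₀}
  have hbad : bad.Countable := countable_setOf_freeEdgeDensity_lt hd hq he₀E
  have hnot : ¬ Set.Ioo u v ⊆ bad := by
    intro hsub
    have h0 : volume bad = 0 := hbad.measure_zero volume
    have h1 : volume (Set.Ioo u v) ≤ volume bad := measure_mono hsub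
    rw [h0, Real.volume_Ioo, nonpos_iff_eq_zero, ENNReal.ofReal_eq_zero] at h1
    linarith
  obtain ⟨p, hp, hpbad⟩ := Set.not_subset.1 hnot
  have hp01 : p ∈ Set.Ioo (0 : ℝ) 1 := ⟨hu.trans_lt hp.1, hp.2.trans_le hv⟩
  have hpc : p ∈ Set.Icc (0 : ℝ) 1 := ⟨hp01.1.le, hp01.2.le⟩
  refine ⟨p, hp, fun e he => ?_⟩
  rw [freeEdgeDensity_eq_of_mem_edgeSet hpc hq he he₀E, wiredEdgeDensity_eq_of_mem_edgeSet hd hpc hq he he₀E]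
  have h1 := freeEdgeDensity_le_wiredEdgeDensity hd hpc hq e₀
  have h2 : ¬ freeEdgeDensity d p q e₀ < wiredEdgeDensity d p q e₀ := fun h => hpbad ⟨hp01, h⟩
  push Not at h2
  exact le_antisymm h1 h2

end MainInequality

/-! ### At a point of equal densities, increasing box events: wired limit ≤ free limit -/

section Consequence

/-- The wired measure of `Λ_{m+k}` on the pull-back of an event `A` of `Λ_m`.
[cite: Grimmett2006, Thm. (4.19)(a)] -/
def boxWiredReal (d : ℕ) (p q : ℝ) (m : ℕ) (A : Set (Percolation.BondConfig ↥(box d m))) (k : ℕ) : ℝ :=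
  (rcMeasure (finsetGraph (zdGraph d) (box d (m + k))) p q
    (wiredBoundary (zdGraph d) (box d (m + k)))).real
      (finsetRestrict (box_mono d (Nat.le_add_right m k)) ⁻¹' A)

/-- The free measure of `Λ_{m+k}` on the pull-back of an event `A` of `Λ_m`.
[cite: Grimmett2006, Thm. (4.19)(a)] -/
def boxFreeReal (d : ℕ) (p q : ℝ) (m : ℕ) (A : Set (Percolation.BondConfig ↥(box d m))) (k : ℕ) : ℝ :=
  (rcMeasure (finsetGraph (zdGraph d) (box d (m + k))) p q ∅).real
    (finsetRestrict (box_mono d (Nat.le_add_right m k)) ⁻¹' A)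

/-- `0 ≤ φ¹_{Λ_{m+k}}(A)`. [cite: Grimmett2006, §4.2] -/
theorem boxWiredReal_nonneg (d : ℕ) (p q : ℝ) (m : ℕ) (A : Set (Percolation.BondConfig ↥(box d m)))
    (k : ℕ) : 0 ≤ boxWiredReal d p q m A k := measureReal_nonneg

/-- `φ⁰_{Λ_{m+k}}(A) ≤ 1`. [cite: Grimmett2006, §4.2] -/
theorem boxFreeReal_le_one (d : ℕ) {p q : ℝ} (hp : p ∈ Set.Icc (0 : ℝ) 1) (hq : 0 < q) (m : ℕ)
    (A : Set (Percolation.BondConfig ↥(box d m))) (k : ℕ) : boxFreeReal d p q m A k ≤ 1 := by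
  haveI := isProbabilityMeasure_rcMeasure (finsetGraph (zdGraph d) (box d (m + k))) hp hq (∅ : Set ↥(box d (m + k)))
  exact measureReal_le_one

/-- **Prop. (4.6) at work in the box `Λ_{m+k}`**: for an increasing event `A` of `Λ_m`,
`φ¹_{Λ_{m+k}}(A) - φ⁰_{Λ_{m+k}}(A) ≤ ∑_{e'' ⊆ Λ_m} (φ¹_{Λ_{m+k}}(J_{e''}) - φ⁰_{Λ_{m+k}}(J_{e''}))`
(sum over all pairs of vertices of `Λ_m`; non-edges contribute `0`).
[cite: Grimmett2006, Prop. (4.6) and Thm. (4.63) (c)⇒(d)] -/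
theorem boxWiredReal_sub_boxFreeReal_le {p q : ℝ} (hp : p ∈ Set.Icc (0 : ℝ) 1) (hq : 1 ≤ q) (m : ℕ)
    {A : Set (Percolation.BondConfig ↥(box d m))} (hA : IsUpperSet A) (k : ℕ) :
    boxWiredReal d p q m A k - boxFreeReal d p q m A k ≤
      ∑ e'' : Sym2 ↥(box d m),
        ((rcMeasure (finsetGraph (zdGraph d) (box d (m + k))) p q
            (wiredBoundary (zdGraph d) (box d (m + k)))).real
              (edgeOpen (edgeLift (box_mono d (Nat.le_add_right m k)) e'')) -
          (rcMeasure (finsetGraph (zdGraph d) (box d (m + k))) p q ∅).real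
              (edgeOpen (edgeLift (box_mono d (Nat.le_add_right m k)) e''))) := by
  classical
  have hq0 : 0 < q := one_pos.trans_le hq
  set h := box_mono d (Nat.le_add_right m k)
  have hmain := real_sub_real_le_sum_edgeOpen_sub
    (G₁ := finsetGraph (zdGraph d) (box d (m + k))) (G₂ := finsetGraph (zdGraph d) (box d (m + k)))
    hp hq0 hp hq0 (B₁ := (∅ : Set ↥(box d (m + k)))) (B₂ := wiredBoundary (zdGraph d) (box d (m + k)))
    (fun U hU => rcMeasure_real_mono_wired_of_isUpperSet _ hp hq (Set.empty_subset _) hU)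
    (Finset.univ.map (edgeLift h)) (A := finsetRestrict h ⁻¹' A)
    (fun _ _ hω hmem => hA (finsetRestrict_mono h hω) hmem)
    (by
      intro ω ω' hωω'
      have : finsetRestrict h ω = finsetRestrict h ω' := by
        ext e''
        rw [mem_finsetRestrict_iff, mem_finsetRestrict_iff]
        exact hωω' _ (Finset.mem_map_of_mem _ (Finset.mem_univ e''))
      simp only [Set.mem_preimage, this])
  rw [Finset.sum_map] at hmain
  exact hmain

/-- Each term of that sum tends to `h¹(p) - h⁰(p)` (for an edge) or is `0` (for a non-edge); at a
point where `h⁰(p) = h¹(p)` for all edges it tends to `0`.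
[cite: Grimmett2006, Thm. (4.63) (c)⇒(d)] -/
theorem tendsto_real_edgeOpen_sub_of_densities_eq (hd : 0 < d) {p q : ℝ} (hp : p ∈ Set.Icc (0 : ℝ) 1)
    (hq : 1 ≤ q) (hgood : ∀ e ∈ (zdGraph d).edgeSet, freeEdgeDensity d p q e = wiredEdgeDensity d p q e)
    (m : ℕ) (e'' : Sym2 ↥(box d m)) :
    Tendsto (fun k : ℕ =>
        (rcMeasure (finsetGraph (zdGraph d) (box d (m + k))) p q
            (wiredBoundary (zdGraph d) (box d (m + k)))).real
              (edgeOpen (edgeLift (box_mono d (Nat.le_add_right m k)) e'')) -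
          (rcMeasure (finsetGraph (zdGraph d) (box d (m + k))) p q ∅).real
              (edgeOpen (edgeLift (box_mono d (Nat.le_add_right m k)) e'')))
      atTop (𝓝 0) := by
  have hq0 : 0 < q := one_pos.trans_le hq
  set e := e''.map Subtype.val with he_def
  by_cases he : e ∈ (zdGraph d).edgeSet
  · -- an edge: the two probabilities are the box edge probabilities of `e`, tending to `h¹ = h⁰`
    have hfun : ∀ k : ℕ,
        (rcMeasure (finsetGraph (zdGraph d) (box d (m + k))) p q
            (wiredBoundary (zdGraph d) (box d (m + k)))).real
              (edgeOpen (edgeLift (box_mono d (Nat.le_add_right m k)) e'')) -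
          (rcMeasure (finsetGraph (zdGraph d) (box d (m + k))) p q ∅).real
              (edgeOpen (edgeLift (box_mono d (Nat.le_add_right m k)) e'')) =
        boxWiredEdgeProb d p q e (m + k) - boxFreeEdgeProb d p q e (m + k) := by
      intro k
      rw [edgeOpen_eq_eOpen_map_val, map_val_edgeLift]
      rfl
    simp_rw [hfun]
    have hshift : Tendsto (fun k : ℕ => m + k) atTop atTop :=
      (tendsto_add_atTop_nat m).congr fun k => add_comm k m
    have h1 := (tendsto_boxWiredEdgeProb hd hp hq e).comp hshift
    have h2 := (tendsto_boxFreeEdgeProb hp hq e).comp hshift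
    have := h1.sub h2
    rw [← hgood e he, sub_self] at this
    exact this
  · -- not an edge: both probabilities vanish
    have hzero : ∀ k : ℕ, ∀ B : Set ↥(box d (m + k)),
        (rcMeasure (finsetGraph (zdGraph d) (box d (m + k))) p q B).real
          (edgeOpen (edgeLift (box_mono d (Nat.le_add_right m k)) e'')) = 0 := by
      intro k B
      refine rcMeasure_real_edgeOpen_eq_zero_of_notMem _ hp hq0 B fun hmem => he ?_
      have := map_val_mem_edgeSet_of_mem_edgeFinset (d := d) (mem_edgeFinset.2 hmem)
      rwa [map_val_edgeLift] at this
    simp_rw [hzero, sub_self]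
    exact tendsto_const_nhds

/-- **Grimmett's Thm. (4.63), (c) ⇒ (d), for increasing box events, in the tree's finite-volume
language**: at a parameter `p` where `h⁰(p,q) = h¹(p,q)` (for all edges of `ℤ^d`; `q ≥ 1`, `d ≥ 1`),
for every `m` and every increasing event `A` of the configurations of `Λ_m`,
`inf_k φ¹_{Λ_{m+k},p,q}(A) ≤ sup_k φ⁰_{Λ_{m+k},p,q}(A)`:
the wired infinite-volume probability of `A` does not exceed the free one.
[cite: Grimmett2006, Thm. (4.63) ((c) ⇒ (d)) with Prop. (4.6)] -/
theorem iInf_boxWiredReal_le_iSup_boxFreeReal (hd : 0 < d) {p q : ℝ} (hp : p ∈ Set.Icc (0 : ℝ) 1)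
    (hq : 1 ≤ q) (hgood : ∀ e ∈ (zdGraph d).edgeSet, freeEdgeDensity d p q e = wiredEdgeDensity d p q e)
    (m : ℕ) {A : Set (Percolation.BondConfig ↥(box d m))} (hA : IsUpperSet A) :
    ⨅ k : ℕ, boxWiredReal d p q m A k ≤ ⨆ k : ℕ, boxFreeReal d p q m A k := by
  have hq0 : 0 < q := one_pos.trans_le hq
  have hbddW : BddBelow (Set.range fun k => boxWiredReal d p q m A k) :=
    ⟨0, by rintro _ ⟨k, rfl⟩; exact boxWiredReal_nonneg d p q m A k⟩
  have hbddF : BddAbove (Set.range fun k => boxFreeReal d p q m A k) :=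
    ⟨1, by rintro _ ⟨k, rfl⟩; exact boxFreeReal_le_one d hp hq0 m A k⟩
  -- the error term
  set R : ℕ → ℝ := fun k => ∑ e'' : Sym2 ↥(box d m),
    ((rcMeasure (finsetGraph (zdGraph d) (box d (m + k))) p q
        (wiredBoundary (zdGraph d) (box d (m + k)))).real
          (edgeOpen (edgeLift (box_mono d (Nat.le_add_right m k)) e'')) -
      (rcMeasure (finsetGraph (zdGraph d) (box d (m + k))) p q ∅).real
          (edgeOpen (edgeLift (box_mono d (Nat.le_add_right m k)) e''))) with hR
  have hRlim : Tendsto R atTop (𝓝 0) := by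
    have := tendsto_finsetSum (Finset.univ : Finset (Sym2 ↥(box d m)))
      (fun e'' _ => tendsto_real_edgeOpen_sub_of_densities_eq hd hp hq hgood m e'')
    simpa [hR] using this
  have hk : ∀ k, (⨅ k : ℕ, boxWiredReal d p q m A k) - (⨆ k : ℕ, boxFreeReal d p q m A k) ≤ R k := by
    intro k
    have h1 : (⨅ k : ℕ, boxWiredReal d p q m A k) ≤ boxWiredReal d p q m A k := ciInf_le hbddW k
    have h2 : boxFreeReal d p q m A k ≤ ⨆ k : ℕ, boxFreeReal d p q m A k := le_ciSup hbddF k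
    have h3 := boxWiredReal_sub_boxFreeReal_le hp hq m hA k
    linarith
  have : (⨅ k : ℕ, boxWiredReal d p q m A k) - (⨆ k : ℕ, boxFreeReal d p q m A k) ≤ 0 :=
    ge_of_tendsto hRlim (Eventually.of_forall hk)
  linarith

/-- **Summary** (`q ≥ 1`, `d ≥ 1`): every non-trivial interval of parameters `(u, v) ⊆ [0, 1]`
contains a `p` at which, for every `m` and every increasing event `A` of the configurations of
`Λ_m`, `inf_k φ¹_{Λ_{m+k},p,q}(A) ≤ sup_k φ⁰_{Λ_{m+k},p,q}(A)` — Grimmett 2006, Thm. (4.63)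
with the countability of `𝒟_q` (Thm. (4.60)), in the tree's finite-volume language.
[cite: Grimmett2006, Thm. (4.63) and Thm. (4.60)] -/
theorem exists_mem_Ioo_iInf_boxWiredReal_le_iSup_boxFreeReal (hd : 0 < d) {q : ℝ} (hq : 1 ≤ q)
    {u v : ℝ} (hu : 0 ≤ u) (huv : u < v) (hv : v ≤ 1) :
    ∃ p ∈ Set.Ioo u v, ∀ (m : ℕ) (A : Set (Percolation.BondConfig ↥(box d m))), IsUpperSet A →
      ⨅ k : ℕ, boxWiredReal d p q m A k ≤ ⨆ k : ℕ, boxFreeReal d p q m A k := by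
  obtain ⟨p, hp, hgood⟩ := exists_mem_Ioo_freeEdgeDensity_eq hd hq hu huv hv
  have hpc : p ∈ Set.Icc (0 : ℝ) 1 := ⟨hu.trans hp.1.le, hp.2.le.trans hv⟩
  exact ⟨p, hp, fun m A hA => iInf_boxWiredReal_le_iSup_boxFreeReal hd hpc hq hgood m hA⟩

end Consequence

end Literature.Probability.LatticeModels

end
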